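import Summits.HubbardSuperconductivity.HubbardSuperconductivity.Theorems.NodalDiracTwistNodalDiracWeakCouplingMoebiusModel
import Summits.HubbardSuperconductivity.HubbardSuperconductivity.Theorems.NodalDiracTwistNodalDiracWeakCouplingMoebiusAbstract
import Summits.HubbardSuperconductivity.HubbardSuperconductivity.Theorems.NodalDiracTwistNodalDiracWeakCouplingConeEnergy
import Summits.HubbardSuperconductivity.HubbardSuperconductivity.Theorems.NodalDiracTwistNodalDiracWeakCouplingAnnulusInvariance

/-!
# Route `NodalDiracTwist` — crux `NodalDiracWeakCoupling`: the reduction to the conical quartet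

Helper file (`--supports stmt-HubbardSuperconductivity-10370`), line `birth` of the crux
`NodalDiracWeakCoupling` (stmt-HubbardSuperconductivity-10370). With the five mathematical stubs of the
line landed (`stub_coneFrame`, `stub_coneEnergy`, `stub_ellipseSqrt`, `stub_moebiusModel`,
`stub_annulusInvariance`) and the lead's assembly `moebiusAbstract_of`, this file records, as
importable theorems:
* `moebiusSign` — the **Longuet-Higgins forward theorem for the spin-twisted Hubbard torus**: an
  exactly two-fold, conically split `(N, S^z = 0)`-sector ground state of `H_L(U, ·)` at a twist `p`
  forces NEGATIVE fine-mesh cyclic overlap products of unit sector ground states (ℤ₂ holonomy `-1`)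
  on every sufficiently small circle about `p` (`= stub_moebiusModel (moebiusAbstract_of stub_coneEnergy)`);
* `sign_from_cone'` — cone data at the four diagonal twists + the crux's LOCUS clause ⇒ the crux's
  SIGN clause on every circle of radius `r < min (c, π - c)` (the line's seam, with `moebiusSign` and
  `stub_annulusInvariance` plugged in);
* `nodalDiracWeakCoupling_of_conicalQuartet` — **the crux `NodalDiracWeakCoupling` follows from the
  single remaining physics statement `stub_conicalQuartet`** (LOCUS verbatim + exactly-two-fold
  conical crossings at the four diagonal twists), kernel-checked: the glue a planner needs to promote
  the conical quartet to an item.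
Sources: Longuet-Higgins, Proc. R. Soc. A 344 (1975) 147; Herzberg–Longuet-Higgins (1963); Hatsugai,
J. Phys. Soc. Jpn. 75 (2006) 123601; Fukui–Hatsugai–Suzuki (2005). No definitions.
-/

-- the mandated namespace `Summit.<Summit>.<Problem>.Theorems` repeats `HubbardSuperconductivity`
-- (single-problem summit, D-0017), which the `dupNamespace` linter flags on every declaration
set_option linter.dupNamespace false

namespace Summit.HubbardSuperconductivity.HubbardSuperconductivity.Theorems.NodalDiracTwist

open Literature.MathematicalPhysics.QuantumLattice
open Summit.HubbardSuperconductivity.HubbardSuperconductivity.Theses.NodalDiracTwist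
open scoped BigOperators ComplexOrder Matrix

/-- **The Möbius sign for the spin-twisted Hubbard torus (Longuet-Higgins forward theorem).** For any
`L, U, N` and any twist `p`: if the `(N, S^z = 0)`-sector ground space of `H_L(U, ·)` at `p` is exactly
two-dimensional and the gap to the second sector level opens at least linearly on a punctured disk
about `p` (variational form), then there is `r₀ > 0` such that on EVERY circle of radius `r ≤ r₀`
about `p`, for all fine discretisations and all unit ground-state choices, the cyclic overlap product
has negative real part. Longuet-Higgins, Proc. R. Soc. A 344 (1975) 147; Hatsugai, J. Phys. Soc.
Jpn. 75 (2006) 123601. [folklore] -/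
theorem moebiusSign :
    ∀ (L : ℕ) [NeZero L] (U : ℝ) (N : ℕ) (p : Fin 2 → ℝ),
      (∃ ψ₁ ψ₂ : Fock (Orb (FermionTorus 2 L)),
          IsGroundStateInSector (spinTwistedHubbardTorus L U p) N 0 ψ₁ ∧
          IsGroundStateInSector (spinTwistedHubbardTorus L U p) N 0 ψ₂ ∧
          star ψ₁ ⬝ᵥ ψ₂ = 0 ∧
          ∀ χ : Fock (Orb (FermionTorus 2 L)),
            IsGroundStateInSector (spinTwistedHubbardTorus L U p) N 0 χ →
              ∃ z₁ z₂ : ℂ, χ = z₁ • ψ₁ + z₂ • ψ₂) →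
      (∃ m : ℝ, 0 < m ∧ ∃ ρ : ℝ, 0 < ρ ∧ ∀ φ : Fin 2 → ℝ,
          0 < (φ 0 - p 0) ^ 2 + (φ 1 - p 1) ^ 2 →
          (φ 0 - p 0) ^ 2 + (φ 1 - p 1) ^ 2 ≤ ρ ^ 2 →
          ∀ ψ χ : Fock (Orb (FermionTorus 2 L)),
            IsGroundStateInSector (spinTwistedHubbardTorus L U φ) N 0 ψ →
            χ ∈ szSector N 0 → star ψ ⬝ᵥ χ = 0 → star χ ⬝ᵥ χ = 1 →
              Matrix.minEnergyOn (spinTwistedHubbardTorus L U φ) (szSector N 0) +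
                  m * Real.sqrt ((φ 0 - p 0) ^ 2 + (φ 1 - p 1) ^ 2) ≤
                (star χ ⬝ᵥ (spinTwistedHubbardTorus L U φ *ᵥ χ)).re) →
      ∃ r₀ : ℝ, 0 < r₀ ∧ ∀ r : ℝ, 0 < r → r ≤ r₀ →
        ∃ n₀ : ℕ, ∀ n ≥ n₀, ∀ ψ : Fin n → Fock (Orb (FermionTorus 2 L)),
          (∀ i : Fin n,
            IsGroundStateInSector (spinTwistedHubbardTorus L U
                (fun ν : Fin 2 => p ν + r *
                      (if ν = 0 then Real.cos (2 * Real.pi * (i : ℕ) / n)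
                        else Real.sin (2 * Real.pi * (i : ℕ) / n)))) N 0 (ψ i) ∧
              star (ψ i) ⬝ᵥ ψ i = 1) →
          (∏ i : Fin n, star (ψ i) ⬝ᵥ ψ (finRotate n i)).re < 0 :=
  stub_moebiusModel (moebiusAbstract_of stub_coneEnergy)

/-- **The seam: cone + annulus invariance + locus ⇒ the crux's SIGN clause** (the line's
`sign_from_cone` with `moebiusSign` and `stub_annulusInvariance` plugged in). For fixed `L, U, N` and
`c ∈ (0, π)`: if the sector ground state is degenerate exactly on the diagonal quartet (`hlocus`) and
each of the four crossings is exactly two-fold and conical (`hcone`), then around every diagonal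
twist `p` and on EVERY circle of radius `r < min (c, π - c)` the fine-mesh cyclic overlap products are
negative: `moebiusSign` gives negativity at radius `min r₀ r`, `stub_annulusInvariance` transports it
to `r`, its uniqueness hypothesis on the closed annulus being derived from `hlocus` (plane geometry +
Gram–Schmidt in the ground eigenspace). [folklore] -/
theorem sign_from_cone' (L : ℕ) [NeZero L] (U : ℝ) (N : ℕ) (c : ℝ) (hc0 : 0 < c)
    (hcπ : c < Real.pi)
    (hlocus : (∀ φ : Fin 2 → ℝ, φ 0 ∈ Set.Ioc (-Real.pi) Real.pi →
        φ 1 ∈ Set.Ioc (-Real.pi) Real.pi →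
          ((∃ ψ₁ ψ₂ : Fock (Orb (FermionTorus 2 L)),
              IsGroundStateInSector (spinTwistedHubbardTorus L U φ) N 0 ψ₁ ∧
              IsGroundStateInSector (spinTwistedHubbardTorus L U φ) N 0 ψ₂ ∧
              star ψ₁ ⬝ᵥ ψ₂ = 0) ↔ (|φ 0| = c ∧ |φ 1| = c))))
    (hcone : ∀ p : Fin 2 → ℝ, |p 0| = c → |p 1| = c →
      (∃ ψ₁ ψ₂ : Fock (Orb (FermionTorus 2 L)),
          IsGroundStateInSector (spinTwistedHubbardTorus L U p) N 0 ψ₁ ∧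
          IsGroundStateInSector (spinTwistedHubbardTorus L U p) N 0 ψ₂ ∧
          star ψ₁ ⬝ᵥ ψ₂ = 0 ∧
          ∀ χ : Fock (Orb (FermionTorus 2 L)),
            IsGroundStateInSector (spinTwistedHubbardTorus L U p) N 0 χ →
              ∃ z₁ z₂ : ℂ, χ = z₁ • ψ₁ + z₂ • ψ₂) ∧
      (∃ m : ℝ, 0 < m ∧ ∃ ρ : ℝ, 0 < ρ ∧ ∀ φ : Fin 2 → ℝ,
          0 < (φ 0 - p 0) ^ 2 + (φ 1 - p 1) ^ 2 →
          (φ 0 - p 0) ^ 2 + (φ 1 - p 1) ^ 2 ≤ ρ ^ 2 →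
          ∀ ψ χ : Fock (Orb (FermionTorus 2 L)),
            IsGroundStateInSector (spinTwistedHubbardTorus L U φ) N 0 ψ →
            χ ∈ szSector N 0 → star ψ ⬝ᵥ χ = 0 → star χ ⬝ᵥ χ = 1 →
              Matrix.minEnergyOn (spinTwistedHubbardTorus L U φ) (szSector N 0) +
                  m * Real.sqrt ((φ 0 - p 0) ^ 2 + (φ 1 - p 1) ^ 2) ≤
                (star χ ⬝ᵥ (spinTwistedHubbardTorus L U φ *ᵥ χ)).re)) :
    ∀ p : Fin 2 → ℝ, |p 0| = c → |p 1| = c → ∀ r : ℝ, 0 < r → r < min c (Real.pi - c) →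
      ∃ n₀ : ℕ, ∀ n ≥ n₀, ∀ ψ : Fin n → Fock (Orb (FermionTorus 2 L)),
        (∀ i : Fin n,
          IsGroundStateInSector (spinTwistedHubbardTorus L U
              (fun ν : Fin 2 => p ν + r *
                    (if ν = 0 then Real.cos (2 * Real.pi * (i : ℕ) / n)
                      else Real.sin (2 * Real.pi * (i : ℕ) / n)))) N 0 (ψ i) ∧
            star (ψ i) ⬝ᵥ ψ i = 1) →
        (∏ i : Fin n, star (ψ i) ⬝ᵥ ψ (finRotate n i)).re < 0 := by
  intro p hp0 hp1 r hr hrlt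
  -- (1) the local Möbius sign at the crossing `p`, on every sufficiently small circle
  obtain ⟨h2, hC⟩ := hcone p hp0 hp1
  obtain ⟨r₀, hr₀, hsmall⟩ := moebiusSign L U N p h2 hC
  have hr₁pos : 0 < min r₀ r := lt_min hr₀ hr
  obtain ⟨n₁, hn₁⟩ := hsmall (min r₀ r) hr₁pos (min_le_left _ _)
  -- (2) transport the sign from radius `min r₀ r` out to radius `r` across the annulus on
  --     which the locus clause makes the sector ground state unique
  refine stub_annulusInvariance L U N p (min r₀ r) r hr₁pos (min_le_right _ _) ?_ ⟨n₁, hn₁⟩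
  intro φ hge hle χ₁ χ₂ hχ₁ hχ₂
  have hπ := Real.pi_pos
  have hrc : r < c := lt_of_lt_of_le hrlt (min_le_left _ _)
  have hrπ : r < Real.pi - c := lt_of_lt_of_le hrlt (min_le_right _ _)
  -- (2a) plane geometry, one coordinate at a time: a point of the closed `r`-disk about a
  --      diagonal twist `p = (±c, ±c)` lies in the open cell, and agrees with `p` in every
  --      coordinate whose modulus is `c`
  have key : ∀ a q : ℝ, |q| = c → (a - q) ^ 2 ≤ r ^ 2 →
      a ∈ Set.Ioc (-Real.pi) Real.pi ∧ (|a| = c → a = q) := by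
    intro a q hq haq
    obtain ⟨h₁, h₂⟩ := abs_le_of_sq_le_sq' haq hr.le
    rcases (abs_eq hc0.le).1 hq with rfl | rfl
    · refine ⟨⟨by linarith, by linarith⟩, fun ha => ?_⟩
      rcases (abs_eq hc0.le).1 ha with h | h
      · exact h
      · exfalso; linarith
    · refine ⟨⟨by linarith, by linarith⟩, fun ha => ?_⟩
      rcases (abs_eq hc0.le).1 ha with h | h
      · exfalso; linarith
      · exact h
  have h0sq : (φ 0 - p 0) ^ 2 ≤ r ^ 2 := le_trans (le_add_of_nonneg_right (sq_nonneg _)) hle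
  have h1sq : (φ 1 - p 1) ^ 2 ≤ r ^ 2 := le_trans (le_add_of_nonneg_left (sq_nonneg _)) hle
  obtain ⟨hφ0, he0⟩ := key (φ 0) (p 0) hp0 h0sq
  obtain ⟨hφ1, he1⟩ := key (φ 1) (p 1) hp1 h1sq
  have hnot : ¬ (|φ 0| = c ∧ |φ 1| = c) := by
    rintro ⟨ha0, ha1⟩
    have e0 := he0 ha0
    have e1 := he1 ha1
    rw [e0, e1, sub_self, sub_self, zero_pow two_ne_zero, add_zero] at hge
    exact absurd hge (not_le.2 (pow_pos hr₁pos 2))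
  -- (2b) off the locus there is no orthogonal pair of sector ground states ...
  have hno : ¬ ∃ ψ₁ ψ₂ : Fock (Orb (FermionTorus 2 L)),
      IsGroundStateInSector (spinTwistedHubbardTorus L U φ) N 0 ψ₁ ∧
      IsGroundStateInSector (spinTwistedHubbardTorus L U φ) N 0 ψ₂ ∧
      star ψ₁ ⬝ᵥ ψ₂ = 0 :=
    fun hex => hnot ((hlocus φ hφ0 hφ1).1 hex)
  -- (2c) ... hence (Gram–Schmidt inside the ground eigenspace of the sector) any two ground
  --      states are parallel
  obtain ⟨hmem₁, hne₁, heig₁⟩ := hχ₁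
  obtain ⟨hmem₂, hne₂, heig₂⟩ := hχ₂
  by_cases hpar : χ₂ - ((star χ₁ ⬝ᵥ χ₂) / (star χ₁ ⬝ᵥ χ₁)) • χ₁ = 0
  · exact ⟨(star χ₁ ⬝ᵥ χ₂) / (star χ₁ ⬝ᵥ χ₁), sub_eq_zero.1 hpar⟩
  · exfalso
    refine hno ⟨χ₁, χ₂ - ((star χ₁ ⬝ᵥ χ₂) / (star χ₁ ⬝ᵥ χ₁)) • χ₁, ⟨hmem₁, hne₁, heig₁⟩,
      ⟨?_, hpar, ?_⟩, ?_⟩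
    · exact Submodule.sub_mem _ hmem₂ (Submodule.smul_mem _ _ hmem₁)
    · rw [Matrix.mulVec_sub, Matrix.mulVec_smul, heig₁, heig₂, smul_sub,
        smul_comm ((star χ₁ ⬝ᵥ χ₂) / (star χ₁ ⬝ᵥ χ₁))]
    · have hne : star χ₁ ⬝ᵥ χ₁ ≠ 0 := fun h => hne₁ (dotProduct_star_self_eq_zero.1 h)
      rw [dotProduct_sub, dotProduct_smul, smul_eq_mul, div_mul_cancel₀ _ hne, sub_self]

/-- **The crux reduces to the conical quartet.** `NodalDiracWeakCoupling` (route NodalDiracTwist,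
stmt-HubbardSuperconductivity-10370) follows from the single physics statement of the line `birth`,
`stub_conicalQuartet`: NodalDirac CONES at arbitrarily weak repulsion — `(U, δ, κ, L₀, c)`, the LOCUS
clause verbatim and, at each of the four diagonal twists, an exactly two-fold sector ground space
whose degeneracy is lifted linearly on a punctured disk. The SIGN clause is supplied by
`sign_from_cone'`. [folklore] -/
theorem nodalDiracWeakCoupling_of_conicalQuartet
    (hQ :
    ∀ U₀ : ℝ, 0 < U₀ → ∃ U ∈ Set.Ioo (0 : ℝ) U₀, ∃ δ ∈ Set.Icc (1 / 10 : ℝ) (3 / 10),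
      ∃ κ : ℝ, 0 < κ ∧ κ < Real.pi ∧ Real.cos κ ≠ 0 ∧ ∀ ε : ℝ, 0 < ε → ∃ L₀ : ℕ,
        ∀ (L : ℕ) [NeZero L], Even L → L₀ ≤ L → (∀ m : ℤ, ε ≤ |L * κ - m * Real.pi|) →
          ∃ c : ℝ, 0 < c ∧ c < Real.pi ∧ |Real.cos c - Real.cos (L * κ)| ≤ ε ∧
            (∀ φ : Fin 2 → ℝ, φ 0 ∈ Set.Ioc (-Real.pi) Real.pi →
              φ 1 ∈ Set.Ioc (-Real.pi) Real.pi →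
                ((∃ ψ₁ ψ₂ : Fock (Orb (FermionTorus 2 L)),
                    IsGroundStateInSector (spinTwistedHubbardTorus L U φ) (2 * ⌊(1 - δ) * (L : ℝ) ^ 2 / 2⌋₊) 0 ψ₁ ∧
                    IsGroundStateInSector (spinTwistedHubbardTorus L U φ) (2 * ⌊(1 - δ) * (L : ℝ) ^ 2 / 2⌋₊) 0 ψ₂ ∧
                    star ψ₁ ⬝ᵥ ψ₂ = 0) ↔ (|φ 0| = c ∧ |φ 1| = c))) ∧
            (∀ p : Fin 2 → ℝ, |p 0| = c → |p 1| = c →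
              (∃ ψ₁ ψ₂ : Fock (Orb (FermionTorus 2 L)),
                  IsGroundStateInSector (spinTwistedHubbardTorus L U p) (2 * ⌊(1 - δ) * (L : ℝ) ^ 2 / 2⌋₊) 0 ψ₁ ∧
                  IsGroundStateInSector (spinTwistedHubbardTorus L U p) (2 * ⌊(1 - δ) * (L : ℝ) ^ 2 / 2⌋₊) 0 ψ₂ ∧
                  star ψ₁ ⬝ᵥ ψ₂ = 0 ∧
                  ∀ χ : Fock (Orb (FermionTorus 2 L)),
                    IsGroundStateInSector (spinTwistedHubbardTorus L U p) (2 * ⌊(1 - δ) * (L : ℝ) ^ 2 / 2⌋₊) 0 χ →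
                      ∃ z₁ z₂ : ℂ, χ = z₁ • ψ₁ + z₂ • ψ₂) ∧
              (∃ m : ℝ, 0 < m ∧ ∃ ρ : ℝ, 0 < ρ ∧ ∀ φ : Fin 2 → ℝ,
                  0 < (φ 0 - p 0) ^ 2 + (φ 1 - p 1) ^ 2 →
                  (φ 0 - p 0) ^ 2 + (φ 1 - p 1) ^ 2 ≤ ρ ^ 2 →
                  ∀ ψ χ : Fock (Orb (FermionTorus 2 L)),
                    IsGroundStateInSector (spinTwistedHubbardTorus L U φ) (2 * ⌊(1 - δ) * (L : ℝ) ^ 2 / 2⌋₊) 0 ψ →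
                    χ ∈ szSector (2 * ⌊(1 - δ) * (L : ℝ) ^ 2 / 2⌋₊) 0 → star ψ ⬝ᵥ χ = 0 → star χ ⬝ᵥ χ = 1 →
                      Matrix.minEnergyOn (spinTwistedHubbardTorus L U φ) (szSector (2 * ⌊(1 - δ) * (L : ℝ) ^ 2 / 2⌋₊) 0) +
                          m * Real.sqrt ((φ 0 - p 0) ^ 2 + (φ 1 - p 1) ^ 2) ≤
                        (star χ ⬝ᵥ (spinTwistedHubbardTorus L U φ *ᵥ χ)).re))) :
    NodalDiracWeakCoupling := by
  intro U₀ hU₀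
  obtain ⟨U, hU, δ, hδ, κ, hκ0, hκπ, hcos, hε⟩ := hQ U₀ hU₀
  refine ⟨U, hU, δ, hδ, κ, hκ0, hκπ, hcos, fun ε hε0 => ?_⟩
  obtain ⟨L₀, hL⟩ := hε ε hε0
  refine ⟨L₀, fun L _ hEven hL₀ hres => ?_⟩
  obtain ⟨c, hc0, hcπ, hcc, hlocus, hcone⟩ := hL L hEven hL₀ hres
  -- the route's inlined `let H` is `spinTwistedHubbardTorus L U` by `rfl`
  exact ⟨c, hc0, hcπ, hcc, hlocus,
    sign_from_cone' L U _ c hc0 hcπ hlocus hcone⟩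


end Summit.HubbardSuperconductivity.HubbardSuperconductivity.Theorems.NodalDiracTwist
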